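import Literature.AnabelianGeometry.AbsoluteAnabelian.AbsTopIII.KummerSeparationLaws
import HarnessLib

/-!
# [AbsTopIII] §1 model-interface laws, layer V: CONSISTENCY witness (the empty model)

Cell abc-iut, NV-lane style evidence for the fifth successor structure `SeparatedKummerModel`
(`KummerSeparationLaws.lean`, abc-iut-w5-d213; layers I–IV `NaturalKummerModel ⊆ TowerKummerModel ⊆
DescentKummerModel ⊆ CoherentKummerModel` are abc-iut-L4-t1's, witnessed in `KummerLawsNonVacuity.lean`): the
structure is JOINTLY SATISFIABLE — witnessed, as for every model interface of the cell (typing policy θ,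
plan/L4/ASSIGNMENTS.md §2), by the DEGENERATE model with no curves at all (`Curve := PEmpty`; every law,
including the three new ones (S-fin) `point_eq_of_finiteIndex_le_conj`, (S-bcfin) `decomp_bcPt_finiteIndex`,
(D-transport) `hasCuspidalDegree_transport`, quantifies over curves and is vacuous; `degSign := 1`).  This is
CONSISTENCY-ONLY evidence (it says nothing about the intended étale-`π₁` model, whose existence is not
asserted anywhere in the tree; see abc-iut-L4-t1's owner read F-t1g4-1 for the truth-at-model status of
(D-transport)); its purpose is to certify in the kernel that the fields carry no hidden contradiction in
their TYPES.  The record literal is abc-iut-L4-t1's layer-IV witness extended by the three layer-V fields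
(filed by the layer I–IV owner for the layer-V author).  Theorems only, no definition.
HONEST FRAMING: nothing here bears on [IUTchIII] Cor. 3.12. [cite: MochizukiAbsTopIII2015, Thm 1.9 p.37]
-/

noncomputable section

namespace Literature.AnabelianGeometry.AbsoluteAnabelian.AbsTopIII

universe u

/-- **The empty model**: `SeparatedKummerModel` (hence every earlier layer) is inhabited by the model with no
curves — CONSISTENCY-ONLY witness (every per-curve law is vacuous). [cite: MochizukiAbsTopIII2015, Thm 1.9 (e) p.38] -/
theorem nonempty_separatedKummerModel : Nonempty SeparatedKummerModel.{u} :=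
  ⟨{
      Curve := PEmpty.{u + 2}
      base := by intro U; exact nomatch U
      instField := by intro U; exact nomatch U
      instCharZero := by intro U; exact nomatch U
      ext := by intro U; exact nomatch U
      galIso := by intro U; exact nomatch U
      cusps := by intro U; exact nomatch U
      IsProper := by intro U; exact nomatch U
      IsScheme := by intro U; exact nomatch U
      genus := by intro U; exact nomatch U
      FunctionField := by intro U; exact nomatch U
      instFunctionField := by intro U; exact nomatch U
      instAlgebra := by intro U; exact nomatch U
      Point := by intro U; exact nomatch U
      decomp := by intro U; exact nomatch U
      IsNFCurve := by intro U; exact nomatch U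
      IsNFPoint := by intro U; exact nomatch U
      IsNFRational := by intro U; exact nomatch U
      IsNFConstant := by intro U; exact nomatch U
      NFFunctionField := by intro U; exact nomatch U
      instNFFunctionField := by intro U; exact nomatch U
      IsStrictlyBelyiType := by intro U; exact nomatch U
      IsCofiniteOpen := by intro U; exact nomatch U
      res := by intro U; exact nomatch U
      IsRationalPt := by intro U; exact nomatch U
      ptSection := by intro U; exact nomatch U
      ptSection_range := by intro U; exact nomatch U
      ord := by intro U; exact nomatch U
      kummerMap := by intro U; exact nomatch U
      res_comp := by intro U; exact nomatch U
      fieldRes := by intro U; exact nomatch U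
      baseRes := by intro U; exact nomatch U
      fieldRes_algebraMap := by intro U; exact nomatch U
      fieldRes_comp := by intro U; exact nomatch U
      ptRes := by intro U; exact nomatch U
      ptRes_comp := by intro U; exact nomatch U
      ord_ptRes := by intro U; exact nomatch U
      decomp_ptRes := by intro U; exact nomatch U
      isRationalPt_ptRes := by intro U; exact nomatch U
      cuspPt := by intro U; exact nomatch U
      cuspPt_inj := by intro U; exact nomatch U
      cuspPt_ne_ptRes := by intro U; exact nomatch U
      exists_ptRes_or_cuspPt := by intro U; exact nomatch U
      cuspPt_isSome := by intro U; exact nomatch U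
      decomp_cuspPt := by intro U; exact nomatch U
      decomp_cuspPt_none := by intro U; exact nomatch U
      isRational_cuspPt_iff := by intro U; exact nomatch U
      isScheme_of_isCofiniteOpen := by intro U; exact nomatch U
      genus_eq_of_isCofiniteOpen := by intro U; exact nomatch U
      exists_open_removing := by intro U; exact nomatch U
      exists_open_between := by intro U; exact nomatch U
      isNFCurve_of_isCofiniteOpen := by intro U; exact nomatch U
      isNFPoint_ptRes := by intro U; exact nomatch U
      isNFRational_fieldRes := by intro U; exact nomatch U
      isNFConstant_baseRes := by intro U; exact nomatch U
      ord_const := by intro U; exact nomatch U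
      isNFConstant_iff := by intro U; exact nomatch U
      kummer_natural := by intro U; exact nomatch U
      degSign := 1
      kummer_degree := by intro U; exact nomatch U
      point_eq_of_decomp_conj := by intro U; exact nomatch U
      evalAt := by intro U; exact nomatch U
      evalAt_const := by intro U; exact nomatch U
      kummerRes_decomp_evalAt := by intro U; exact nomatch U
      kummerRes_decomp_const_eq_zero_iff := by intro U; exact nomatch U
      IsBaseChangeOf := by intro U; exact nomatch U
      bc := by intro U; exact nomatch U
      isBaseChange_bc := by intro U; exact nomatch U
      isOpenInjective_bc := by intro U; exact nomatch U
      isBaseChangeOf_refl := by intro U; exact nomatch U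
      isBaseChangeOf_trans := by intro U; exact nomatch U
      bc_refl := by intro U; exact nomatch U
      bc_comp := by intro U; exact nomatch U
      bcBase := by intro U; exact nomatch U
      finite_bcBase := by intro U; exact nomatch U
      bcField := by intro U; exact nomatch U
      bcField_algebraMap := by intro U; exact nomatch U
      bcBase_refl := by intro U; exact nomatch U
      bcField_refl := by intro U; exact nomatch U
      bcBase_comp := by intro U; exact nomatch U
      bcField_comp := by intro U; exact nomatch U
      bcEmb := by intro U; exact nomatch U
      bcEmb_comp_bcBase := by intro U; exact nomatch U
      bcEmb_comp_bcBase' := by intro U; exact nomatch U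
      bcEmb_refl := by intro U; exact nomatch U
      exists_baseChange := by intro U; exact nomatch U
      isBaseChangeOf_of_range_subset := by intro U; exact nomatch U
      bcPt := by intro U; exact nomatch U
      bcPt_surjective := by intro U; exact nomatch U
      bcPt_refl := by intro U; exact nomatch U
      bcPt_comp := by intro U; exact nomatch U
      ord_bcPt := by intro U; exact nomatch U
      decomp_bcPt := by intro U; exact nomatch U
      isRationalPt_of_bcPt := by intro U; exact nomatch U
      isNFPoint_bcPt := by intro U; exact nomatch U
      exists_cusp_bc := by intro U; exact nomatch U
      isRational_cusp_bc := by intro U; exact nomatch U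
      isScheme_bc := by intro U; exact nomatch U
      isProper_bc := by intro U; exact nomatch U
      genus_bc := by intro U; exact nomatch U
      isNFCurve_bc := by intro U; exact nomatch U
      isNFRational_bcField := by intro U; exact nomatch U
      isNFConstant_bcBase := by intro U; exact nomatch U
      isNFConstant_iff_mem_kbarNF := by intro U; exact nomatch U
      bc_res_comm := by intro U; exact nomatch U
      bcField_fieldRes := by intro U; exact nomatch U
      bcBase_baseRes := by intro U; exact nomatch U
      exists_bc_open := by intro U; exact nomatch U
      bcPt_ptRes := by intro U; exact nomatch U
      kummer_bc := by intro U; exact nomatch U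
      geomField := by intro U; exact nomatch U
      instGeomField := by intro U; exact nomatch U
      toGeom := by intro U; exact nomatch U
      toGeom_comp_bcField := by intro U; exact nomatch U
      geomBase := by intro U; exact nomatch U
      toGeom_algebraMap := by intro U; exact nomatch U
      geom_exhaust := by intro U; exact nomatch U
      nfToGeom := by intro U; exact nomatch U
      nfAlgebra := by intro U; exact nomatch U
      nfToGeom_algebraMap := by intro U; exact nomatch U
      isNFRational_iff_mem_range := by intro U; exact nomatch U
      nf_isAlgFunctionField := by intro U; exact nomatch U
      nf_genus := by intro U; exact nomatch U
      nfPlace := by intro U; exact nomatch U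
      nfPlace_bcPt := by intro U; exact nomatch U
      exists_common_of_nfPlace_eq := by intro U; exact nomatch U
      nfPlace_surjective := by intro U; exact nomatch U
      ord_nfPlace := by intro U; exact nomatch U
      mem_unitsWithValueOne_nfPlace_iff := by intro U; exact nomatch U
      cuspRes := by intro U; exact nomatch U
      decomp_cuspRes := by intro U; exact nomatch U
      exists_cuspRes_eq := by intro U; exact nomatch U
      cuspPt_comp_some := by intro U; exact nomatch U
      cuspPt_comp_none := by intro U; exact nomatch U
      decomp_inf_geom := by intro U; exact nomatch U
      point_eq_of_finiteIndex_le_conj := by intro U; exact nomatch U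
      decomp_bcPt_finiteIndex := by intro U; exact nomatch U
      hasCuspidalDegree_transport := by intro U; exact nomatch U
    }⟩

end Literature.AnabelianGeometry.AbsoluteAnabelian.AbsTopIII
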